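import Literature.Uncategorized.FarFlatTransfer
import HarnessLib

/-!
# FarFlatTransfer — the discharge

Proof of the named literature fact `Literature.Uncategorized.FarFlatTransfer` (stub F of the
`NeckGapDecay` skeleton, relocated by the gate into `Literature/Uncategorized/FarFlatTransfer.lean`):

* `Literature.Uncategorized.FarFlatTransfer_holds : FarFlatTransfer`.

CLAIM.  For a `C⁴` final-state decomposition `d` with pairwise distinct hole velocities and
orthochronous label boosts, a hole `i` (background `Bᵢ = boostedKerr(Λ, c, M, a)`, rest time `t`,
rest radius `r`, excision `ρᵢ`) and a non-decreasing wall `W` with `W(s)/s → 0`: for every `ε > 0`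
there are `P`, `T` such that for `τ ≥ T` the far collar `S = {t = τ, max(ρᵢ(x⁰), P) + 1 ≤ r ≤ W(x⁰)}`
(i) lies in the flat domain `U₀` and (ii) carries `C²` sup norm `≤ ε` of `(Φ^*g − η) + (η − g_{Bᵢ})`.

PROOF (Literature-side port of the Summits proof `stub_farFlatTransfer`, same architecture).
Write `x = Λz + c`, `z = τe₀ + z̃`, `‖z̃‖ ≤ r + |a| ≤ W(x⁰) + |a|`; then
`|x⁰ − γτ| ≤ ‖Λ‖ W(x⁰) + const` (`γ = (Λe₀)⁰ > 0`), and monotonicity plus sublinearity of `W` give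
`γτ/2 ≤ x⁰ ≤ 2γτ` on the collar for large `τ` (`eventually_labTime`): lab times `→ ∞` uniformly, so
`τ₀ < x⁰`, the flat `C⁴` certificate on the lab slab through `x` is eventually `≤ ε/2`
(`d.tendsto_deviationCk_flat`), and `W(x⁰), ρⱼ(x⁰) = o(τ)`.  For `j ≠ i` the rest position of `x`
relative to hole `j` is `τu + Λⱼ⁻¹Λz̃ + Λⱼ⁻¹(c − cⱼ)`, `u = Λⱼ⁻¹Λe₀` unit timelike with `ũ ≠ 0`
(`u = ±e₀` would mean `Λe₀ = ±Λⱼe₀`, excluded by distinct velocities and orthochronicity), so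
`rⱼ(x) ≥ τ‖ũ‖ − O(W(x⁰) + 1) > ρⱼ(x⁰)` eventually (`eventually_recede`); for `j = i`,
`rᵢ ≥ ρᵢ(x⁰) + 1`; hence `x ∈ U₀` (`d.setOf_lt_excision_subset_flatDomain`).  (ii) Both summands
are smooth at collar points (`Spacetime.contDiffAt_deviationExtend_model`, `contDiffAt_boostedKsPert`),
so `Dᵐ` splits; the first term is bounded by the flat slab certificate, the second by
`Cₘ/r ≤ Cₘ/(P+1) ≤ ε/2` (`norm_iteratedFDeriv_boostedKsPert_le`).

## References

* R. P. Kerr, A. Schild, *A new class of vacuum solutions of the Einstein field equations* (1965),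
  §3 (key `KerrSchild1965`): the Kerr–Schild form `η + 2H ℓ ⊗ ℓ`, smooth off the ring, `H = O(M/r)`.
* B. O'Neill, *Semi-Riemannian geometry*, 1983, Ch. 9, p. 233 (key `ONeill1983`): `O(1,3)`, unit
  timelike vectors.
* M. Dafermos, G. Holzegel, I. Rodnianski, M. Taylor, arXiv:2104.08222, §1 (key `arXiv210408222`):
  unweighted `Cᵏ` deviation norms on slabs.
-/

namespace Literature.Uncategorized

open scoped Manifold ContDiff Topology ENNReal
open Filter Set MeasureTheory Topology Literature.Geometry.Lorentzian

/-! ## Real-variable tails -/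

/-- A sublinear function is eventually below every positive multiple of the identity. [folklore] -/
private theorem eventually_le_mul_of_tendsto_div {f : ℝ → ℝ}
    (hf : Tendsto (fun s ↦ f s / s) atTop (𝓝 0)) {δ : ℝ} (hδ : 0 < δ) :
    ∀ᶠ s in atTop, f s ≤ δ * s := by
  filter_upwards [hf.eventually (gt_mem_nhds hδ), eventually_gt_atTop 0] with s hs hs0
  exact ((div_lt_iff₀ hs0).1 hs).le

/-- Tail transfer: an eventual property holds, eventually in `τ`, at all `t ≥ γτ/2` (`γ > 0`).
[folklore] -/
private theorem eventually_forall_ge_half {p : ℝ → Prop} (hp : ∀ᶠ s in atTop, p s) {γ : ℝ}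
    (hγ : 0 < γ) : ∀ᶠ τ in atTop, ∀ t, γ * τ / 2 ≤ t → p t :=
  ((Tendsto.const_mul_atTop hγ tendsto_id).atTop_div_const (by norm_num : (0 : ℝ) < 2)
    |>.eventually_forall_ge_atTop hp)

/-- **Lab time versus rest time under a sublinear wall.** For `γ > 0`, `n ≥ 0`, `A`, and a
non-decreasing `W` with `W(s)/s → 0`: eventually in `τ`, every `t` with `|t − γτ| ≤ n W(t) + A`
satisfies `γτ/2 ≤ t ≤ 2γτ` (if `t` were below the sublinearity threshold `s₁`, monotonicity would give
`t ≥ γτ − n W(s₁) − A`; beyond it, `n W(t) ≤ t/4`). [folklore] -/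
private theorem eventually_labTime {W : ℝ → ℝ} (hWm : Monotone W)
    (hWs : Tendsto (fun s ↦ W s / s) atTop (𝓝 0)) {γ : ℝ} (hγ : 0 < γ) {n : ℝ} (hn : 0 ≤ n)
    (A : ℝ) :
    ∀ᶠ τ in atTop, ∀ t : ℝ, |t - γ * τ| ≤ n * W t + A → γ * τ / 2 ≤ t ∧ t ≤ 2 * γ * τ := by
  have hδ : 0 < 1 / (4 * (n + 1)) := by positivity
  obtain ⟨s₀, hs₀⟩ := eventually_atTop.1 (eventually_le_mul_of_tendsto_div hWs hδ)
  set s₁ : ℝ := max s₀ 1 with hs₁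
  filter_upwards [eventually_ge_atTop ((s₁ + n * |W s₁| + |A|) / γ),
    eventually_ge_atTop (3 * |A| / γ)] with τ hτ1 hτ2 t ht
  have hγτ1 : s₁ + n * |W s₁| + |A| ≤ γ * τ := by linarith [(div_le_iff₀ hγ).1 hτ1, mul_comm τ γ]
  have hγτ2 : 3 * |A| ≤ γ * τ := by linarith [(div_le_iff₀ hγ).1 hτ2, mul_comm τ γ]
  obtain ⟨ht1, ht2⟩ := abs_le.1 ht
  have hA1 := le_abs_self A
  have hA2 := neg_abs_le A
  have hts : s₁ ≤ t := by
    refine le_of_not_gt fun h ↦ ?_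
    have hW : n * W t ≤ n * |W s₁| :=
      mul_le_mul_of_nonneg_left ((hWm h.le).trans (le_abs_self _)) hn
    linarith
  have ht0 : 0 < t := lt_of_lt_of_le (lt_of_lt_of_le one_pos (le_max_right _ _)) hts
  have hnW : n * W t ≤ t / 4 := by
    calc n * W t ≤ n * (1 / (4 * (n + 1)) * t) :=
          mul_le_mul_of_nonneg_left (hs₀ t ((le_max_left _ _).trans hts)) hn
      _ = n / (n + 1) * (t / 4) := by field_simp
      _ ≤ 1 * (t / 4) := by gcongr; exact (div_le_one (by positivity)).2 (by linarith)
      _ = t / 4 := one_mul _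
  constructor <;> linarith

/-- **Receding tubes.** For `σ, γ > 0`, `μ ≥ 0`, `β`, and sublinear `W`, `ρ`: eventually in `τ`,
`ρ(t) + μ W(t) + β < στ` for all `t ∈ [γτ/2, 2γτ]`. [folklore] -/
private theorem eventually_recede {W ρ : ℝ → ℝ} (hWs : Tendsto (fun s ↦ W s / s) atTop (𝓝 0))
    (hρ : Tendsto (fun s ↦ ρ s / s) atTop (𝓝 0)) {σ γ μ : ℝ} (hσ : 0 < σ) (hγ : 0 < γ)
    (hμ : 0 ≤ μ) (β : ℝ) :
    ∀ᶠ τ in atTop, ∀ t : ℝ, γ * τ / 2 ≤ t → t ≤ 2 * γ * τ → ρ t + μ * W t + β < σ * τ := by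
  have hδ : 0 < σ / (4 * γ * (μ + 1)) := by positivity
  filter_upwards [eventually_forall_ge_half (eventually_le_mul_of_tendsto_div hWs hδ) hγ,
    eventually_forall_ge_half (eventually_le_mul_of_tendsto_div hρ hδ) hγ,
    eventually_gt_atTop (2 * |β| / σ)] with τ hWτ hρτ hτβ t ht1 ht2
  have hβ : 2 * |β| < σ * τ := by linarith [(div_lt_iff₀ hσ).1 hτβ, mul_comm τ σ]
  have key : ρ t + μ * W t ≤ σ * τ / 2 := by
    calc ρ t + μ * W t
        ≤ σ / (4 * γ * (μ + 1)) * t + μ * (σ / (4 * γ * (μ + 1)) * t) :=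
          add_le_add (hρτ t ht1) (mul_le_mul_of_nonneg_left (hWτ t ht1) hμ)
      _ = σ / (4 * γ) * t := by field_simp; ring
      _ ≤ σ / (4 * γ) * (2 * γ * τ) := mul_le_mul_of_nonneg_left ht2 (by positivity)
      _ = σ * τ / 2 := by field_simp; ring
  linarith [le_abs_self β]

/-! ## Kinematics of a boosted hole (coordinate bookkeeping in `E4`, O'Neill 1983, Ch. 9) -/

/-- `η(u, u) = −(u⁰)² + ‖u~‖²` (O'Neill 1983, Ch. 3, p. 55). [cite: ONeill1983, Ch. 3, p. 55] -/
private theorem minkowski_bilin_self (u : E4) :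
    Minkowski.bilin u u = -(u 0) ^ 2 + E4.spatialNorm u ^ 2 := by
  rw [Minkowski.bilin_apply, E4.spatialNorm_sq, Fin.sum_univ_three]
  simp only [Fin.succ_zero_eq_one, Fin.succ_one_eq_two]
  rw [show (2 : Fin 3).succ = (3 : Fin 4) from rfl]
  ring

/-- `‖u‖² = (u⁰)² + ‖u~‖²` for the Euclidean norm of `E4` (coordinate bookkeeping). [folklore] -/
private theorem norm_sq_eq_sq_add_spatialNorm_sq (u : E4) :
    ‖u‖ ^ 2 = u 0 ^ 2 + E4.spatialNorm u ^ 2 := by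
  rw [EuclideanSpace.real_norm_sq_eq, Fin.sum_univ_four, E4.spatialNorm_sq]
  ring

/-- A spatial vector has Euclidean norm equal to its spatial norm (bookkeeping). [folklore] -/
private theorem norm_eq_spatialNorm_of_apply_zero_eq_zero {w : E4} (hw : w 0 = 0) :
    ‖w‖ = E4.spatialNorm w := by
  have h := norm_sq_eq_sq_add_spatialNorm_sq w
  rw [hw] at h
  nlinarith [norm_nonneg w, E4.spatialNorm_nonneg w]

/-- `‖z − z⁰ e₀‖ = ‖z̃‖`: the vector `z − z⁰e₀` is spatial with the same spatial part as `z`.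
[folklore] -/
private theorem norm_sub_smul_e₀ (z : E4) : ‖z - z 0 • E4.basisVector 0‖ = E4.spatialNorm z := by
  have h0 : (z - z 0 • E4.basisVector 0) 0 = 0 := by simp
  have he : E4.spatial (E4.basisVector 0) = 0 := by ext i; simp
  rw [norm_eq_spatialNorm_of_apply_zero_eq_zero h0, E4.spatialNorm, E4.spatialNorm, map_sub, map_smul,
    he, smul_zero, sub_zero]

/-- `‖z̃‖ ≤ r_a(z) + |a|` for the Kerr–Schild radius (`‖z̃‖² − a² ≤ r²`, Visser arXiv:0706.0622,
(35)). [folklore] -/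
private theorem spatialNorm_le_radius_add_abs (a : ℝ) (z : E4) :
    E4.spatialNorm z ≤ Kerr.radius a z + |a| := by
  have h := Kerr.spatialNorm_sq_sub_sq_le_radius_sq a z
  have hr := Kerr.radius_nonneg a z
  have h2 : E4.spatialNorm z ^ 2 ≤ (Kerr.radius a z + |a|) ^ 2 := by nlinarith [abs_nonneg a, sq_abs a]
  exact (pow_le_pow_iff_left₀ (E4.spatialNorm_nonneg z) (by positivity) two_ne_zero).1 h2

/-- **Lab time of a point of the rest slab `{t = τ}`**: with `z = Λ⁻¹(x − c)`, `z⁰ = τ`,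
`|x⁰ − (τ(Λe₀)⁰ + c⁰)| ≤ ‖Λ‖‖z̃‖` (`x = τΛe₀ + Λz̃ + c`). [folklore] -/
private theorem abs_labTime_sub_le (Λ : lorentzGroup) (c x : E4) {τ : ℝ}
    (hτ : poincareInv Λ c x 0 = τ) :
    |x 0 - (τ * ((Λ : E4 ≃L[ℝ] E4) (E4.basisVector 0)) 0 + c 0)| ≤
      ‖((Λ : E4 ≃L[ℝ] E4) : E4 →L[ℝ] E4)‖ * E4.spatialNorm (poincareInv Λ c x) := by
  set L : E4 ≃L[ℝ] E4 := (Λ : E4 ≃L[ℝ] E4) with hL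
  set z : E4 := poincareInv Λ c x with hz
  set zs : E4 := z - z 0 • E4.basisVector 0 with hzs
  have hx : x = L z + c := by rw [hz, poincareInv, ← hL, L.apply_symm_apply, sub_add_cancel]
  have hLz : L z = z 0 • L (E4.basisVector 0) + L zs := by rw [hzs, map_sub, map_smul, add_sub_cancel]
  have hx0 : x 0 = τ * (L (E4.basisVector 0)) 0 + (L zs) 0 + c 0 := by
    have h := congrArg (fun v : E4 ↦ v 0) hx
    simp only [hLz, PiLp.add_apply, PiLp.smul_apply, smul_eq_mul] at h
    rw [← hτ]
    linarith
  rw [show x 0 - (τ * (L (E4.basisVector 0)) 0 + c 0) = (L zs) 0 by rw [hx0]; ring]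
  calc |(L zs) 0| ≤ ‖L zs‖ := (Real.norm_eq_abs _).symm.trans_le (PiLp.norm_apply_le (L zs) 0)
    _ ≤ ‖(L : E4 →L[ℝ] E4)‖ * ‖zs‖ := (L : E4 →L[ℝ] E4).le_opNorm zs
    _ = ‖(L : E4 →L[ℝ] E4)‖ * E4.spatialNorm z := by rw [norm_sub_smul_e₀]

/-- **Rest-frame distance from another hole grows linearly.** With `z = Λ⁻¹(x − c)`, `z⁰ = τ ≥ 0`,
the spatial part of `Λ'⁻¹(x − c') = τΛ'⁻¹Λe₀ + Λ'⁻¹Λz̃ + Λ'⁻¹(c − c')` has norm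
`≥ τ‖(Λ'⁻¹Λe₀)~‖ − ‖Λ'⁻¹‖‖Λ‖‖z̃‖ − ‖Λ'⁻¹(c − c')‖`. [folklore] -/
private theorem spatialNorm_poincareInv_ge (Λ Λ' : lorentzGroup) (c c' x : E4) {τ : ℝ}
    (hτ : poincareInv Λ c x 0 = τ) (h0 : 0 ≤ τ) :
    τ * E4.spatialNorm ((Λ' : E4 ≃L[ℝ] E4).symm ((Λ : E4 ≃L[ℝ] E4) (E4.basisVector 0))) -
        ‖((Λ' : E4 ≃L[ℝ] E4).symm : E4 →L[ℝ] E4)‖ * ‖((Λ : E4 ≃L[ℝ] E4) : E4 →L[ℝ] E4)‖ *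
          E4.spatialNorm (poincareInv Λ c x) -
        ‖(Λ' : E4 ≃L[ℝ] E4).symm (c - c')‖ ≤
      E4.spatialNorm (poincareInv Λ' c' x) := by
  set L : E4 ≃L[ℝ] E4 := (Λ : E4 ≃L[ℝ] E4) with hL
  set L' : E4 ≃L[ℝ] E4 := (Λ' : E4 ≃L[ℝ] E4) with hL'
  set z : E4 := poincareInv Λ c x with hz
  set zs : E4 := z - z 0 • E4.basisVector 0 with hzs
  have hx : x = L z + c := by rw [hz, poincareInv, ← hL, L.apply_symm_apply, sub_add_cancel]
  have hLz : L z = z 0 • L (E4.basisVector 0) + L zs := by rw [hzs, map_sub, map_smul, add_sub_cancel]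
  have hsp : E4.spatial (poincareInv Λ' c' x) = τ • E4.spatial (L'.symm (L (E4.basisVector 0))) +
      E4.spatial (L'.symm (L zs)) + E4.spatial (L'.symm (c - c')) := by
    have hw : poincareInv Λ' c' x = τ • L'.symm (L (E4.basisVector 0)) + L'.symm (L zs) + L'.symm (c - c') := by
      show L'.symm (x - c') = _
      rw [hx, add_sub_assoc, map_add, hLz, map_add, map_smul, hτ]
    rw [hw, map_add, map_add, map_smul]
  have h1 : ‖τ • E4.spatial (L'.symm (L (E4.basisVector 0)))‖ =
      τ * E4.spatialNorm (L'.symm (L (E4.basisVector 0))) := by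
    rw [norm_smul, Real.norm_of_nonneg h0, E4.spatialNorm]
  have h2 : ‖E4.spatial (L'.symm (L zs))‖ ≤
      ‖(L'.symm : E4 →L[ℝ] E4)‖ * ‖(L : E4 →L[ℝ] E4)‖ * E4.spatialNorm z := by
    calc ‖E4.spatial (L'.symm (L zs))‖ ≤ ‖L'.symm (L zs)‖ := E4.spatialNorm_le_norm _
      _ ≤ ‖(L'.symm : E4 →L[ℝ] E4)‖ * ‖L zs‖ := (L'.symm : E4 →L[ℝ] E4).le_opNorm _
      _ ≤ ‖(L'.symm : E4 →L[ℝ] E4)‖ * (‖(L : E4 →L[ℝ] E4)‖ * ‖zs‖) :=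
          mul_le_mul_of_nonneg_left ((L : E4 →L[ℝ] E4).le_opNorm zs) (norm_nonneg _)
      _ = _ := by rw [norm_sub_smul_e₀, mul_assoc]
  have h3 : ‖E4.spatial (L'.symm (c - c'))‖ ≤ ‖L'.symm (c - c')‖ := E4.spatialNorm_le_norm _
  have h4 : ∀ A B C : E3, ‖A‖ ≤ ‖A + B + C‖ + ‖B‖ + ‖C‖ := fun A B C ↦
    calc ‖A‖ = ‖(A + B + C) - C - B‖ := by congr 1; abel
      _ ≤ ‖A + B + C - C‖ + ‖B‖ := norm_sub_le _ _
      _ ≤ ‖A + B + C‖ + ‖B‖ + ‖C‖ := by linarith [norm_sub_le (A + B + C) C]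
  have h5 := h4 (τ • E4.spatial (L'.symm (L (E4.basisVector 0)))) (E4.spatial (L'.symm (L zs)))
    (E4.spatial (L'.symm (c - c')))
  rw [← hsp] at h5
  simp only [E4.spatialNorm] at h1 h2 ⊢
  linarith

/-- **Distinct future unit timelike vectors have distinct directions**: for `Λ, Λ' ∈ O(1,3)` with
`Λe₀ ≠ Λ'e₀` and `(Λe₀)⁰, (Λ'e₀)⁰ > 0`, the relative velocity `u = Λ'⁻¹Λe₀` (`η(u,u) = −1`) has
non-zero spatial part: `ũ = 0` would force `u = ±e₀`, i.e. `Λe₀ = ±Λ'e₀`.  O'Neill 1983, Ch. 9,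
p. 233. [cite: ONeill1983, Ch. 9, p. 233] -/
private theorem spatialNorm_relVelocity_pos (Λ Λ' : lorentzGroup)
    (hne : (Λ : E4 ≃L[ℝ] E4) (E4.basisVector 0) ≠ (Λ' : E4 ≃L[ℝ] E4) (E4.basisVector 0))
    (h : 0 < ((Λ : E4 ≃L[ℝ] E4) (E4.basisVector 0)) 0)
    (h' : 0 < ((Λ' : E4 ≃L[ℝ] E4) (E4.basisVector 0)) 0) :
    0 < E4.spatialNorm ((Λ' : E4 ≃L[ℝ] E4).symm ((Λ : E4 ≃L[ℝ] E4) (E4.basisVector 0))) := by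
  set u : E4 := (Λ' : E4 ≃L[ℝ] E4).symm ((Λ : E4 ≃L[ℝ] E4) (E4.basisVector 0)) with hu
  refine (E4.spatialNorm_nonneg u).lt_of_ne fun h0 ↦ hne ?_
  have hη : Minkowski.bilin u u = -1 := by
    rw [hu, lorentzGroup.minkowski_symm_apply, Λ.2, Minkowski.bilin_basisVector_zero]
  rw [minkowski_bilin_self, ← h0] at hη
  have hsp : E4.spatial u = 0 := norm_eq_zero.1 h0.symm
  have hue : u = u 0 • E4.basisVector 0 := by
    ext μ
    refine Fin.cases (by simp) (fun j ↦ ?_) μ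
    have hj : u j.succ = 0 := by simpa [E4.spatial_apply] using congrArg (fun v : E3 ↦ v j) hsp
    simp [hj, Fin.succ_ne_zero]
  have hLe : (Λ : E4 ≃L[ℝ] E4) (E4.basisVector 0) = u 0 • (Λ' : E4 ≃L[ℝ] E4) (E4.basisVector 0) := by
    calc (Λ : E4 ≃L[ℝ] E4) (E4.basisVector 0) = (Λ' : E4 ≃L[ℝ] E4) u := by
          rw [hu, ContinuousLinearEquiv.apply_symm_apply]
      _ = (Λ' : E4 ≃L[ℝ] E4) (u 0 • E4.basisVector 0) := by rw [← hue]
      _ = _ := map_smul _ _ _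
  have h0' : ((Λ : E4 ≃L[ℝ] E4) (E4.basisVector 0)) 0 =
      u 0 * ((Λ' : E4 ≃L[ℝ] E4) (E4.basisVector 0)) 0 := by
    rw [hLe, PiLp.smul_apply, smul_eq_mul]
  have hu0 : 0 < u 0 := by
    refine lt_of_not_ge fun hle ↦ ?_
    have : ((Λ : E4 ≃L[ℝ] E4) (E4.basisVector 0)) 0 ≤ 0 := h0' ▸ mul_nonpos_of_nonpos_of_nonneg hle h'.le
    linarith
  have hu1 : u 0 = 1 := by nlinarith
  rwa [hu1, one_smul] at hLe

/-! ## The discharge -/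

/-- **F — far flat transfer holds.**  Kinematics (`eventually_labTime`, `eventually_recede`,
`spatialNorm_relVelocity_pos`: O'Neill 1983, Ch. 9, p. 233) put hole `i`'s far collar inside the
flat domain `U₀` with lab times `x⁰ ≥ γτ/2 → ∞`; there both summands are smooth
(`Spacetime.contDiffAt_deviationExtend_model`; `contDiffAt_boostedKsPert`, Kerr–Schild 1965, §3), so
each `Dᵐ`, `m ≤ 2`, splits: the first term is bounded by the flat `C⁴` slab certificate
`d.tendsto_deviationCk_flat` on the lab slab through the point (unweighted `Cᵏ` deviation norms as
in DHRT arXiv:2104.08222, §1), the second by the `Cₘ/r ≤ Cₘ/(P+1) ≤ ε/2` tail of the boosted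
Kerr–Schild perturbation (`norm_iteratedFDeriv_boostedKsPert_le`, Kerr–Schild 1965, §3).  This is the
Literature-side port of the Summits proof `stub_farFlatTransfer`.
[cite: KerrSchild1965, §3] [cite: ONeill1983, Ch. 9, p. 233] [cite: arXiv210408222, §1] -/
theorem FarFlatTransfer_holds : FarFlatTransfer := by
  intro 𝓢 O d hDV horth i W hWm hWs ε hε
  set Λ : lorentzGroup := (d.motion i).1 with hΛ
  set c : E4 := (d.motion i).2 with hc
  set M : ℝ := d.mass i with hM
  set a : ℝ := d.spin i with ha
  set γ : ℝ := ((Λ : E4 ≃L[ℝ] E4) (E4.basisVector 0)) 0 with hγ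
  have hγ0 : 0 < γ := horth i
  set nL : ℝ := ‖((Λ : E4 ≃L[ℝ] E4) : E4 →L[ℝ] E4)‖ with hnL
  have hnL0 : 0 ≤ nL := norm_nonneg _
  set F₁ : E4 → E4 →L[ℝ] E4 →L[ℝ] ℝ :=
    𝓢.deviationExtend (Minkowski.backgroundOn d.flatDomain) d.flatChart with hF₁
  set K : E4 → E4 →L[ℝ] E4 →L[ℝ] ℝ := fun y ↦ boostedKerrBilin Λ c M a y - Minkowski.bilin with hK
  have hΦ : ContMDiff 𝓘(ℝ, E4) (𝓡 4) ∞ d.flatChart := d.isLateChart_flat.contMDiff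
  -- (1) decay constants of the boosted Kerr–Schild perturbation and the radius `P`
  choose C R hR hCR using fun n ↦ norm_iteratedFDeriv_boostedKsPert_le Λ c M a n
  set Cmax : ℝ := ∑ n ∈ Finset.range 3, |C n| with hCmax
  set Rmax : ℝ := ∑ n ∈ Finset.range 3, R n with hRmax
  have hCn : ∀ n ≤ 2, |C n| ≤ Cmax := fun n hn ↦
    Finset.single_le_sum (f := fun n ↦ |C n|) (fun _ _ ↦ abs_nonneg _)
      (Finset.mem_range.mpr (Nat.lt_succ_of_le hn))
  have hRn : ∀ n ≤ 2, R n ≤ Rmax := fun n hn ↦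
    Finset.single_le_sum (f := R) (fun n _ ↦ (hR n).le) (Finset.mem_range.mpr (Nat.lt_succ_of_le hn))
  have hCmax0 : 0 ≤ Cmax := Finset.sum_nonneg fun _ _ ↦ abs_nonneg _
  set P : ℝ := Rmax + 2 * Cmax / ε with hP
  have hP1 : 2 * Cmax / ε ≤ P := by linarith [(hR 0).trans_le (hRn 0 (Nat.zero_le 2))]
  have hP2 : Rmax ≤ P := by linarith [show 0 ≤ 2 * Cmax / ε by positivity]
  -- (2) tails in the rest time `τ`
  have hT := eventually_labTime hWm hWs hγ0 hnL0 (nL * |a| + |c 0|)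
  have hE1 : ∀ᶠ τ in atTop, ∀ t, γ * τ / 2 ≤ t → d.τ₀ < t :=
    eventually_forall_ge_half (eventually_gt_atTop d.τ₀) hγ0
  have hE2 : ∀ᶠ τ in atTop, ∀ t, γ * τ / 2 ≤ t →
      𝓢.deviationCk (Minkowski.backgroundOn d.flatDomain) d.flatChart 4 t ≤ ENNReal.ofReal (ε / 2) :=
    eventually_forall_ge_half
      (d.tendsto_deviationCk_flat.eventually (ge_mem_nhds (ENNReal.ofReal_pos.2 (half_pos hε)))) hγ0
  have hRj : ∀ j : Fin d.N, ∀ᶠ τ in atTop, j ≠ i → ∀ t : ℝ, γ * τ / 2 ≤ t → t ≤ 2 * γ * τ →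
      d.excision j t +
          ‖(((d.motion j).1 : E4 ≃L[ℝ] E4).symm : E4 →L[ℝ] E4)‖ * nL * W t +
          (‖(((d.motion j).1 : E4 ≃L[ℝ] E4).symm : E4 →L[ℝ] E4)‖ * nL * |a| +
            ‖((d.motion j).1 : E4 ≃L[ℝ] E4).symm (c - (d.motion j).2)‖ + |d.spin j|) <
        E4.spatialNorm (((d.motion j).1 : E4 ≃L[ℝ] E4).symm
          ((Λ : E4 ≃L[ℝ] E4) (E4.basisVector 0))) * τ := by
    intro j
    by_cases hj : j = i
    · exact Eventually.of_forall fun _ h ↦ absurd hj h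
    · exact (eventually_recede hWs (d.tendsto_excision_div j)
        (spatialNorm_relVelocity_pos Λ (d.motion j).1 (hDV i j (Ne.symm hj)) hγ0 (horth j)) hγ0
        (mul_nonneg (norm_nonneg _) hnL0) _).mono fun τ h _ ↦ h
  obtain ⟨T, hTall⟩ := eventually_atTop.1
    (hT.and (hE1.and (hE2.and ((eventually_all.2 hRj).and (eventually_ge_atTop (0 : ℝ))))))
  refine ⟨P, T, fun τ hτ ↦ ?_⟩
  obtain ⟨hTτ, hE1τ, hE2τ, hRτ, hτ0⟩ := hTall τ hτ
  intro B S
  -- (3) pointwise kinematics on the collar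
  have key : ∀ x ∈ S, x.1 ∈ (d.flatDomain : Set E4) ∧ γ * τ / 2 ≤ x.1 0 ∧
      P + 1 ≤ Kerr.radius a (poincareInv Λ c x.1) := by
    intro x hx
    obtain ⟨hxt, hxr, hxW⟩ := hx
    have hxt' : poincareInv Λ c x.1 0 = τ := hxt
    have hxr' : max (d.excision i (x.1 0)) P + 1 ≤ Kerr.radius a (poincareInv Λ c x.1) := hxr
    have hxW' : Kerr.radius a (poincareInv Λ c x.1) ≤ W (x.1 0) := hxW
    have hsz : E4.spatialNorm (poincareInv Λ c x.1) ≤ W (x.1 0) + |a| :=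
      (spatialNorm_le_radius_add_abs a _).trans (by linarith)
    have hlab : |x.1 0 - (τ * γ + c 0)| ≤ nL * E4.spatialNorm (poincareInv Λ c x.1) :=
      abs_labTime_sub_le Λ c x.1 hxt'
    have hA : |x.1 0 - γ * τ| ≤ nL * W (x.1 0) + (nL * |a| + |c 0|) := by
      have h1 : |x.1 0 - γ * τ| ≤ |x.1 0 - (τ * γ + c 0)| + |c 0| := by
        have h := abs_sub_le (x.1 0) (τ * γ + c 0) (γ * τ)
        rwa [show τ * γ + c 0 - γ * τ = c 0 by ring] at h
      have h2 : nL * E4.spatialNorm (poincareInv Λ c x.1) ≤ nL * (W (x.1 0) + |a|) :=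
        mul_le_mul_of_nonneg_left hsz hnL0
      linarith
    obtain ⟨hlo, hhi⟩ := hTτ (x.1 0) hA
    have hPr : P + 1 ≤ Kerr.radius a (poincareInv Λ c x.1) :=
      le_trans (by linarith [le_max_right (d.excision i (x.1 0)) P]) hxr'
    refine ⟨d.setOf_lt_excision_subset_flatDomain ⟨hE1τ _ hlo, fun j ↦ ?_⟩, hlo, hPr⟩
    by_cases hj : j = i
    · rw [hj]
      exact lt_of_lt_of_le (by linarith [le_max_left (d.excision i (x.1 0)) P]) hxr'
    · -- another hole: its excised tube has receded
      have hrec := hRτ j hj (x.1 0) hlo hhi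
      have hkin : τ * E4.spatialNorm (((d.motion j).1 : E4 ≃L[ℝ] E4).symm
            ((Λ : E4 ≃L[ℝ] E4) (E4.basisVector 0))) -
          ‖(((d.motion j).1 : E4 ≃L[ℝ] E4).symm : E4 →L[ℝ] E4)‖ * nL *
            E4.spatialNorm (poincareInv Λ c x.1) -
          ‖((d.motion j).1 : E4 ≃L[ℝ] E4).symm (c - (d.motion j).2)‖ ≤
          E4.spatialNorm (poincareInv (d.motion j).1 (d.motion j).2 x.1) :=
        spatialNorm_poincareInv_ge Λ (d.motion j).1 c (d.motion j).2 x.1 hxt' hτ0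
      have hrad : E4.spatialNorm (poincareInv (d.motion j).1 (d.motion j).2 x.1) ≤
          Kerr.radius (d.spin j) (poincareInv (d.motion j).1 (d.motion j).2 x.1) + |d.spin j| :=
        spatialNorm_le_radius_add_abs _ _
      have hμ : ‖(((d.motion j).1 : E4 ≃L[ℝ] E4).symm : E4 →L[ℝ] E4)‖ * nL *
            E4.spatialNorm (poincareInv Λ c x.1) ≤
          ‖(((d.motion j).1 : E4 ≃L[ℝ] E4).symm : E4 →L[ℝ] E4)‖ * nL * (W (x.1 0) + |a|) :=
        mul_le_mul_of_nonneg_left hsz (mul_nonneg (norm_nonneg _) hnL0)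
      linarith
  refine ⟨fun x hx ↦ (key x hx).1, ?_⟩
  -- (4) the analytic estimate on the collar
  refine supCkENorm_le_of_forall_le fun m hm y hy ↦ ?_
  obtain ⟨x, hxS, rfl⟩ := hy
  obtain ⟨hxU, hlo, hPr⟩ := key x hxS
  have hr0 : 0 < Kerr.radius a (poincareInv Λ c x.1) := by linarith
  have h1 : ContDiffAt ℝ m F₁ x.1 :=
    (𝓢.contDiffAt_deviationExtend_model (Minkowski.backgroundOn d.flatDomain) hΦ ⟨x.1, hxU⟩
      contDiffAt_const).of_le (by exact_mod_cast le_top)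
  have hfun : (fun y ↦ Minkowski.bilin - boostedKerrBilin Λ c M a y) = -K := by
    funext y
    simp only [hK, Pi.neg_apply]
    exact (neg_sub (boostedKerrBilin Λ c M a y) Minkowski.bilin).symm
  have h2 : ContDiffAt ℝ m (fun y ↦ Minkowski.bilin - boostedKerrBilin Λ c M a y) x.1 :=
    hfun ▸ (contDiffAt_boostedKsPert (M := M) hr0).neg
  rw [fun_iteratedFDeriv_add_apply h1 h2, hfun, iteratedFDeriv_neg_apply]
  calc ‖iteratedFDeriv ℝ m F₁ x.1 + -iteratedFDeriv ℝ m K x.1‖ₑ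
      ≤ ‖iteratedFDeriv ℝ m F₁ x.1‖ₑ + ‖-iteratedFDeriv ℝ m K x.1‖ₑ := enorm_add_le _ _
    _ ≤ ENNReal.ofReal (ε / 2) + ENNReal.ofReal (ε / 2) := add_le_add ?_ ?_
    _ = ENNReal.ofReal ε := by rw [← ENNReal.ofReal_add (by positivity) (by positivity), add_halves]
  · -- the flat certificate on the lab slab through the point
    have hmem : x.1 ∈ Subtype.val '' (Minkowski.backgroundOn d.flatDomain).timeSlab (x.1 0) :=
      ⟨⟨x.1, hxU⟩, rfl, rfl⟩
    exact (enorm_iteratedFDeriv_le_supCkENorm (hm.trans (by norm_num)) hmem F₁).trans (hE2τ _ hlo)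
  · -- the boosted Kerr–Schild tail
    rw [enorm_neg]
    refine enorm_le_ofReal_of_norm_le ?_
    calc ‖iteratedFDeriv ℝ m K x.1‖ ≤ C m / Kerr.radius a (poincareInv Λ c x.1) :=
          hCR m x.1 (by linarith [hRn m hm])
      _ ≤ Cmax / Kerr.radius a (poincareInv Λ c x.1) :=
          div_le_div_of_nonneg_right ((le_abs_self _).trans (hCn m hm)) hr0.le
      _ ≤ ε / 2 := by
          rw [div_le_iff₀ hr0]
          linarith [(div_le_iff₀ hε).1 (show 2 * Cmax / ε ≤ Kerr.radius a (poincareInv Λ c x.1) by linarith)]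

end Literature.Uncategorized
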